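import Summits.Ventures.HodgeRepro.Night1ProductWeilMatching

/-!
# Which coordinate Hodge classes are generated by divisors: a coordinate wedge `e_U` lies in the
`k`-fold products of divisor classes iff `U` is a disjoint union of `k` balanced pairs

Blind re-derivation cell `pub-hodge-repro`, seat `night-1` (gen 5, eighth file).  Imports night-1's
`Night1ProductWeilMatching` (the divisor-generated part `divisorPower` / `divisorPowerIn` of
`Night1ProductWeilExceptional`, the concatenation `concatPairs`, `prod_ofFn_coordWedgeOn`, and the
complementary pairings) and, through it, typer-2's `balancedWedgesOn` / `jointEigenspaceOn_eq_span`.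

The Weil lines of a corner product are one kind of coordinate Hodge class (the coordinate wedges `e_U`
with `U` a Pohlmann set are ALL the coordinate Hodge classes of a CM product, typer-2's census).  The
arguments of the previous two files use nothing about lines beyond the dual functional of the wedge; this
file records the general criterion, for ANY family `Ψ : Γ → Finset X` of cocharacters on a finite set `X`:

* `coordDual s` — the dual functional `⟨e^*_U, ·⟩` of an injective `s : Fin n → X` (`lineDual e σ` is
  `coordDual (lineEnum e σ)`), with `coordDual_coordWedgeOn_self` (`= 1`) and
  `coordDual_coordWedgeOn_eq_zero_of_notMem_range` (a wedge missing a point of `U` pairs to `0`);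
* `IsBalancedPairing Ψ s` — `k` injective balanced pairs (for every `γ` exactly one point of each pair in
  `Ψ γ`); **`coordWedgeOn_concatPairs_mem_divisorPowerIn`** — their concatenated wedge is a `k`-fold
  product of divisor classes;
* **`exists_isBalancedPairing_of_mem_divisorPowerIn`** — conversely, if the wedge `e_u` of an injective
  `u : Fin 2k → X` is a `k`-fold product of divisor classes, then `range u` is the disjoint union of `k`
  balanced pairs (some product of balanced pairs pairs non-trivially with `e_u`, so it covers `range u`);
* **`coordWedgeOn_mem_divisorPowerIn_iff`** — the criterion: `e_u ∈ D^k ↔ ∃ balanced pairing s,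
  range (concatPairs s) = range u`.

Read through typer-2's dictionary (paper-level, NIGHT1.md §12): a coordinate Hodge class of a CM product
is a polynomial in divisor classes exactly when its index set splits into pairs each of which is a
divisor class (a Pohlmann 2-set).  The Weil lines are the instance `U = {(i, σ)}` (`Night1ProductWeilMatching`:
the pairs are then complementary corners).  Nothing geometric is built; nothing here says anything about
the status of the Hodge conjecture for CM abelian varieties, which is NOT proved.
-/

set_option autoImplicit false

open Finset Module
open scoped Pointwise

namespace HodgeRepro.RouteC

open CMHodgeOn

section Dual

variable {X : Type*} [DecidableEq X]

/-- The dual functional `⟨e^*_U, ·⟩` of a family `s : Fin n → X`: the pairing with the wedge of the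
coordinate projections `proj (s 0) ∧ ⋯ ∧ proj (s (n-1))`. -/
noncomputable def coordDual {n : ℕ} (s : Fin n → X) : Module.Dual ℂ (⋀[ℂ]^n (X → ℂ)) :=
  exteriorPower.pairingDual ℂ (X → ℂ) n
    (exteriorPower.ιMulti ℂ n fun j => (LinearMap.proj (s j) : (X → ℂ) →ₗ[ℂ] ℂ))

/-- `⟨e^*_U, e_U⟩ = 1` for injective `s`. -/
theorem coordDual_coordWedgeOn_self {n : ℕ} {s : Fin n → X} (hs : Function.Injective s) :
    coordDual s (coordWedgeOn n s) = 1 :=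
  pairingDual_proj_coordWedgeOn hs

/-- A coordinate wedge missing a point of `U` pairs to `0` with `e^*_U` (a zero column in the pairing
matrix). -/
theorem coordDual_coordWedgeOn_eq_zero_of_notMem_range {n : ℕ} (s : Fin n → X) {t : Fin n → X}
    {a : Fin n} (ha : s a ∉ Set.range t) : coordDual s (coordWedgeOn n t) = 0 := by
  unfold coordDual coordWedgeOn
  rw [exteriorPower.pairingDual_ιMulti_ιMulti]
  refine Matrix.det_eq_zero_of_column_eq_zero a fun j => ?_
  rw [Matrix.of_apply, LinearMap.proj_apply, coordVecOn_apply, if_neg]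
  intro hEq
  exact ha ⟨j, hEq.symm⟩

/-- If `⟨e^*_U, e_t⟩ ≠ 0` then `t` covers `U`. -/
theorem mem_range_of_coordDual_ne_zero {n : ℕ} (s : Fin n → X) {t : Fin n → X}
    (h : coordDual s (coordWedgeOn n t) ≠ 0) (a : Fin n) : s a ∈ Set.range t := by
  by_contra ha
  exact h (coordDual_coordWedgeOn_eq_zero_of_notMem_range s ha)

/-- If `⟨e^*_U, e_t⟩ ≠ 0` with `s` injective, then `range t = range s` (`|range t| ≤ n = |range s|`). -/
theorem range_eq_of_coordDual_ne_zero {n : ℕ} {s : Fin n → X} (hs : Function.Injective s)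
    {t : Fin n → X} (h : coordDual s (coordWedgeOn n t) ≠ 0) : Set.range t = Set.range s := by
  have hsub : univ.image s ⊆ univ.image t := by
    intro x hx
    rw [mem_image] at hx
    obtain ⟨a, _, rfl⟩ := hx
    obtain ⟨b, hb⟩ := mem_range_of_coordDual_ne_zero s h a
    exact mem_image.2 ⟨b, mem_univ b, hb⟩
  have hcard : (univ.image t).card ≤ (univ.image s).card := by
    rw [card_image_of_injective _ hs]
    exact card_image_le
  have heq : univ.image t = univ.image s := (eq_of_subset_of_card_le hsub hcard).symm
  ext x
  constructor
  · rintro ⟨b, rfl⟩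
    have : t b ∈ univ.image s := heq ▸ mem_image_of_mem t (mem_univ b)
    obtain ⟨a, _, ha⟩ := mem_image.1 this
    exact ⟨a, ha⟩
  · rintro ⟨a, rfl⟩
    have : s a ∈ univ.image t := heq.symm ▸ mem_image_of_mem s (mem_univ a)
    obtain ⟨b, _, hb⟩ := mem_image.1 this
    exact ⟨b, hb⟩

end Dual

section Criterion

variable {X : Type*} [Fintype X] [DecidableEq X] {Γ : Type*}

omit [Fintype X] in
/-- A **balanced pairing**: `k` injective pairs, each with exactly one point in `Ψ γ` for every `γ` (each
pair a Pohlmann 2-set, i.e. a divisor class). -/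
def IsBalancedPairing (Ψ : Γ → Finset X) {k : ℕ} (s : Fin k → Fin 2 → X) : Prop :=
  ∀ j, Function.Injective (s j) ∧ ∀ γ, (univ.image (s j) ∩ Ψ γ).card = 1

/-- **A concatenation of balanced pairs is a `k`-fold product of divisor classes.** -/
theorem coordWedgeOn_concatPairs_mem_divisorPowerIn (Ψ : Γ → Finset X) {k : ℕ}
    {s : Fin k → Fin 2 → X} (hs : IsBalancedPairing Ψ s) :
    coordWedgeOn (2 * k) (concatPairs s) ∈ divisorPowerIn Ψ k := by
  rw [mem_divisorPowerIn_iff, divisorPower_eq_span]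
  refine Submodule.subset_span ?_
  rw [Set.mem_pow]
  refine ⟨fun j => ⟨(coordWedgeOn 2 (s j) : ExteriorAlgebra ℂ (X → ℂ)), ?_⟩, ?_⟩
  · exact ⟨coordWedgeOn (2 * 1) (s j), ⟨s j, (hs j).1, (hs j).2, rfl⟩, rfl⟩
  · exact prod_ofFn_coordWedgeOn s

/-- **A `k`-fold product of divisor classes pairing non-trivially with `e_U` covers `U` by balanced
pairs**: if `e_u` (`u` injective) is not killed by `e^*_U` on `D^k`… more precisely, if `⟨e^*_U, ·⟩` does not
vanish on `D^k` then `range u` is the range of a concatenation of balanced pairs. -/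
theorem exists_isBalancedPairing_of_coordDual_ne_zero (Ψ : Γ → Finset X) {k : ℕ} {u : Fin (2 * k) → X}
    (hu : Function.Injective u) {ω : ⋀[ℂ]^(2 * k) (X → ℂ)} (hω : ω ∈ divisorPowerIn Ψ k)
    (hne : coordDual u ω ≠ 0) :
    ∃ s : Fin k → Fin 2 → X, IsBalancedPairing Ψ s ∧ Set.range (concatPairs s) = Set.range u := by
  by_contra hcon
  push Not at hcon
  apply hne
  rw [mem_divisorPowerIn_iff, divisorPower_eq_span] at hω
  have hP : ∃ ω' : ⋀[ℂ]^(2 * k) (X → ℂ),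
      (ω' : ExteriorAlgebra ℂ (X → ℂ)) = (ω : ExteriorAlgebra ℂ (X → ℂ)) ∧ coordDual u ω' = 0 := by
    refine Submodule.span_induction (p := fun x _ => ∃ ω' : ⋀[ℂ]^(2 * k) (X → ℂ),
      (ω' : ExteriorAlgebra ℂ (X → ℂ)) = x ∧ coordDual u ω' = 0) ?_ ?_ ?_ ?_ hω
    · intro x hx
      obtain ⟨f, hf⟩ := Set.mem_pow.1 hx
      have hf' : ∀ j : Fin k, ∃ s : Fin 2 → X, Function.Injective s ∧
          (∀ γ, (univ.image s ∩ Ψ γ).card = 1) ∧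
            (coordWedgeOn 2 s : ExteriorAlgebra ℂ (X → ℂ)) = (f j : ExteriorAlgebra ℂ (X → ℂ)) := by
        intro j
        obtain ⟨ω₂, ⟨s, hs, hbal, hω₂⟩, hx₂⟩ := (f j).2
        exact ⟨s, hs, hbal, by rw [← hx₂, ← hω₂]; rfl⟩
      choose s hs hbal hfs using hf'
      refine ⟨coordWedgeOn (2 * k) (concatPairs s), ?_, ?_⟩
      · rw [← hf, ← prod_ofFn_coordWedgeOn]
        congr 2
        funext j
        exact hfs j
      · by_contra hne'
        exact hcon s (fun j => ⟨hs j, hbal j⟩) (range_eq_of_coordDual_ne_zero hu hne')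
    · exact ⟨0, by simp, map_zero _⟩
    · rintro x y _ _ ⟨ω₁, h₁, h₁'⟩ ⟨ω₂, h₂, h₂'⟩
      exact ⟨ω₁ + ω₂, by simp [h₁, h₂], by rw [map_add, h₁', h₂', add_zero]⟩
    · rintro a x _ ⟨ω₁, h₁, h₁'⟩
      exact ⟨a • ω₁, by simp [h₁], by rw [map_smul, h₁', smul_zero]⟩
  obtain ⟨ω', h₁, h₂⟩ := hP
  rw [← Subtype.ext h₁]
  exact h₂

/-- **A coordinate wedge that is a `k`-fold product of divisor classes is a union of balanced pairs.** -/
theorem exists_isBalancedPairing_of_mem_divisorPowerIn (Ψ : Γ → Finset X) {k : ℕ}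
    {u : Fin (2 * k) → X} (hu : Function.Injective u) (h : coordWedgeOn (2 * k) u ∈ divisorPowerIn Ψ k) :
    ∃ s : Fin k → Fin 2 → X, IsBalancedPairing Ψ s ∧ Set.range (concatPairs s) = Set.range u := by
  refine exists_isBalancedPairing_of_coordDual_ne_zero Ψ hu h ?_
  rw [coordDual_coordWedgeOn_self hu]
  exact one_ne_zero

/-- **The criterion**: the coordinate wedge `e_U` of an injective `u` is a `k`-fold product of divisor
classes iff `U = range u` is the disjoint union of `k` balanced pairs (each a divisor class). -/
theorem coordWedgeOn_mem_divisorPowerIn_iff (Ψ : Γ → Finset X) {k : ℕ} {u : Fin (2 * k) → X}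
    (hu : Function.Injective u) :
    coordWedgeOn (2 * k) u ∈ divisorPowerIn Ψ k ↔
      ∃ s : Fin k → Fin 2 → X, IsBalancedPairing Ψ s ∧ Set.range (concatPairs s) = Set.range u := by
  refine ⟨exists_isBalancedPairing_of_mem_divisorPowerIn Ψ hu, ?_⟩
  rintro ⟨s, hs, hrange⟩
  -- the two injective families with the same range differ by a permutation: equal wedges up to sign
  have hmem₁ : ∀ a, ∃ b, concatPairs s b = u a := by
    intro a
    have : u a ∈ Set.range (concatPairs s) := by
      rw [hrange]
      exact Set.mem_range_self a
    exact this
  have hmem₂ : ∀ b, ∃ a, u a = concatPairs s b := by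
    intro b
    have : concatPairs s b ∈ Set.range u := by
      rw [← hrange]
      exact Set.mem_range_self b
    exact this
  have hinj : Function.Injective (concatPairs s) := by
    have h1 : (univ.image (concatPairs s)) = univ.image u := by
      ext x
      simp only [mem_image, mem_univ, true_and]
      constructor
      · rintro ⟨b, rfl⟩
        exact hmem₂ b
      · rintro ⟨a, rfl⟩
        exact hmem₁ a
    have h2 : (univ.image (concatPairs s)).card = (univ : Finset (Fin (2 * k))).card := by
      rw [h1, card_image_of_injective _ hu]
    have h3 := Finset.card_image_iff.1 h2
    rw [Finset.coe_univ] at h3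
    exact Set.injOn_univ.1 h3
  obtain ⟨σ, hσ⟩ : ∃ σ : Equiv.Perm (Fin (2 * k)), u = concatPairs s ∘ σ := by
    have hbij : ∀ a, ∃ b, concatPairs s b = u a := hmem₁
    choose g hg using hbij
    have hginj : Function.Injective g := fun a b hab => hu (by rw [← hg a, ← hg b, hab])
    refine ⟨Equiv.ofBijective g ((Fintype.bijective_iff_injective_and_card g).2 ⟨hginj, rfl⟩), ?_⟩
    funext a
    simp only [Function.comp_apply, Equiv.ofBijective_apply, hg]
  rw [hσ, coordWedgeOn, show (fun i => coordVecOn ((concatPairs s ∘ σ) i)) =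
      (fun i => coordVecOn (concatPairs s i)) ∘ σ from rfl, AlternatingMap.map_perm, Units.smul_def]
  exact Submodule.smul_mem _ _ (coordWedgeOn_concatPairs_mem_divisorPowerIn Ψ hs)

end Criterion

/-! ### The Weil lines as the instance `U = {(i, σ)}` -/

section Lines

variable {G : Type*} [Group G] [DecidableEq G] [Fintype G] {ι : Type*} [Fintype ι] [DecidableEq ι]

omit [Group G] [DecidableEq G] [Fintype G] [Fintype ι] [DecidableEq ι] in
/-- `lineDual e σ` is the dual functional of the `σ`-line. -/
theorem lineDual_eq_coordDual {k : ℕ} (e : Fin (2 * k) ≃ ι) (σ : G) :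
    lineDual e σ = coordDual (lineEnum e σ) := rfl

/-- **The Weil line `e_{line σ}` is a product of divisor classes iff the corners admit a complementary
pairing** (the general criterion at `U = {(i, σ)}`: a balanced pairing of the line is a complementary
pairing of the corners, `Night1ProductWeilMatching`). -/
theorem weilWedgeProd_mem_divisorPowerIn_iff {k : ℕ} (e : Fin (2 * k) ≃ ι) (T : ι → Finset G) (σ : G) :
    weilWedgeProd e σ ∈ divisorPowerIn (fun g : G => prodTypeSet fun i => g • T i) k ↔
      HasComplPairing k T := by
  constructor
  · intro h
    by_contra hnp
    have h0 := lineDual_eq_zero_of_mem_divisorPowerIn_of_not_hasComplPairing e T hnp σ h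
    rw [lineDual_weilWedgeProd_self] at h0
    exact one_ne_zero h0
  · intro hp
    exact weilSpaceProd_le_divisorPowerIn_of_hasComplPairing T hp e (weilWedgeProd_mem_weilSpaceProd k e σ)

end Lines

end HodgeRepro.RouteC
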